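import Literature.Topology.FourManifolds.HomotopySpheresStablyParallelizableStandard
import Literature.Topology.FourManifolds.HomotopySpheresStablyParallelizableProofs
import Literature.Topology.FourManifolds.HomotopySpheresStablyParallelizableSeven
import Literature.Topology.FourManifolds.SmoothPoincareTwoHolds
import Literature.AlgebraicTopology.FundamentalGroup.RotationGroupSO3
import Mathlib.Geometry.Manifold.Instances.Sphere
import HarnessLib

/-!
# Kervaire–Milnor's Theorem 3.1 in dimension `3`: Case 1 of the printed proof (`π₂(SO) = 0`), proved

Topic `Literature/Topology/FourManifolds`, sibling of
`HomotopySpheresStablyParallelizableStandard.lean`, towards the named fact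
`Literature.Topology.FourManifolds.HomotopySphere.isStablyParallelizable` (Kervaire–Milnor,
*Groups of homotopy spheres I*, Ann. of Math. 77 (1963), Thm. 3.1, p. 508: "Every homotopy
sphere is s-parallelizable"). The printed proof (p. 508): the only obstruction to the triviality
of `τ ⊕ ε¹` over a homotopy `n`-sphere `Σ` is a class `oₙ(Σ)` with coefficients in
`πₙ₋₁(SO_{n+1}) = πₙ₋₁(SO)`; "these stable groups have been computed by Bott, as follows, for
`n ≥ 2`" (table `ℤ, ℤ₂, ℤ₂, 0, ℤ, 0, 0, 0` for `n ≡ 0, …, 7 (mod 8)`); "Case 1. `n ≡ 3, 5, 6 or 7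
(modulo 8)`. Then `πₙ₋₁(SO) = 0`, so that `oₙ(Σ)` is trivially zero."

The tree now holds every ingredient of Case 1 except the values of `πₙ₋₁(SO)`, all PROVED:
the stable tangent bundle of a homotopy sphere is framed off a point
(`HomotopySphere.hasStableTangentFramingAlong_compl_singleton_holds`,
`HomotopySpheresStablyParallelizableProofs.lean`: covering homotopy theorem for stable framings
over the contractible punctured sphere); the clutching theorem
(`HomotopySphere.isStablyParallelizable_succ_of`, `HomotopySpheresStablyParallelizable.lean`);
and the translation of its input `SphereMapsToStableFramesExtend n` into Mathlib's homotopy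
groups, `↔ π_ n (SO(n + 2), 1) = 0` (`n ≥ 1`,
`sphereMapsToStableFramesExtend_iff_subsingleton_homotopyGroup_specialOrthogonalGroup`,
`…Orthogonal.lean`), with `π_ n (SO(n + 1), 1) = 0` already sufficient
(`sphereMapsToStableFramesExtend_of_specialOrthogonalGroup_succ`, `…Seven.lean`, by the
surjectivity half of stability). This file assembles them and supplies the one value of the
table that is elementary, `π₂(SO(3)) = 0` (everything PROVED; no definitions, no named facts):

* §1 `Literature.Topology.FourManifolds.subsingleton_homotopyGroup_two_specialOrthogonalGroup_three`:
  **`π₂(SO(3), 1) = 0`** for Mathlib's `HomotopyGroup (Fin 2)` of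
  `Matrix.specialOrthogonalGroup (Fin 3) ℝ`. Proof (Hatcher, *Algebraic Topology*, §3.D:
  `S³ → SO(3)` is the universal cover; Prop. 4.1: a covering projection induces isomorphisms
  on `πₙ`, `n ≥ 2`; Cor. 4.9: `πᵢ(Sⁿ) = 0` for `i < n`): a
  continuous `k : 𝕊² → SO(3)` lifts through the tree's covering homomorphism
  `rotHom : S³ → SO3` (`isCoveringMap_rotHom`, `RotationGroupSO3.lean`) by Mathlib's lifting
  criterion `IsCoveringMap.existsUnique_continuousMap_lifts` (`𝕊²` is simply connected —
  `simplyConnectedSpace_euclideanSphere` — and locally path connected as a charted space); the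
  lift is null-homotopic because `π₂(S³) = 0` at every base point (the tree's
  `subsingleton_homotopyGroup_sphere` for the unit sphere of `ℍ ≅ ℝ⁴`, and
  `homotopic_const_of_sphere_of_subsingleton_homotopyGroup`, Hatcher §4.1 (3) ⇒ (1)); composing
  with `rotHom` and with the identification of Mathlib's `SO(3)` with the tree's `SO3` (same
  subspace of `M₃(ℝ)`) makes `k` null-homotopic, and
  `subsingleton_homotopyGroup_specialOrthogonalGroup_of_nullhomotopic` (Hatcher §4.1 (1) ⇒ (3))
  concludes. By the stability already in the tree,
  `Literature.Topology.FourManifolds.subsingleton_homotopyGroup_two_specialOrthogonalGroup`: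
  **`π₂(SO(D), 1) = 0` for every `D ≥ 3`** (the entry `π₂ O(n) = 0` of the table in Hatcher,
  Example 4.55; Kervaire–Milnor's `π₂(SO) = 0`).
* §2 `HomotopySphere.isStablyParallelizable_of_subsingleton_homotopyGroup_specialOrthogonalGroup`
  (and `…_succ`): **Case 1 parametrised** — for `n ≥ 1`, `π_ n (SO(n + 2), 1) = 0` (resp.
  `π_ n (SO(n + 1), 1) = 0`) implies that every homotopy `(n + 1)`-sphere is s-parallelizable,
  with no further hypothesis.
* §3 `HomotopySphere.isStablyParallelizable_three`: **Thm. 3.1 in dimension `3`,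
  unconditionally** — Case 1 at `n = 3` with §1. (The earlier
  `HomotopySphere.isStablyParallelizable_three_of` needed Perelman's theorem; Kervaire–Milnor,
  p. 507: "If the Poincaré hypothesis were proved, it would follow that `Θ₃` is zero" — their own
  proof of Thm. 3.1 at `n = 3` is Case 1, as here.) With `Θ₂ = 0` now a theorem of the tree
  (`nonemptyDiffeomorphSphere_two_holds`, `SmoothPoincareTwoHolds.lean`),
  `HomotopySphere.isStablyParallelizable_two` and `HomotopySphere.isStablyParallelizable_of_le_three`
  are unconditional, and `HomotopySphere.isStablyParallelizable_of_four_le` reduces the named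
  fact to dimensions `n ≥ 4`.
* §4 `HomotopySphere.isStablyParallelizable_five_of`, `…_six_of`,
  `…_seven_of_specialOrthogonalGroup`: dimensions `5, 6, 7` from the single Bott values
  `π₄(SO(6)) = 0`, `π₅(SO(7)) = 0`, `π₆(SO(8)) = 0` respectively (stated for Mathlib's
  `HomotopyGroup`); and the assembly `HomotopySphere.isStablyParallelizable_of_bott_of_cases`:
  the named fact follows from (i) Bott's values `π_ (n - 1) (SO(n + 1), 1) = 0` for `n ≥ 5`,
  `n ≡ 3, 5, 6, 7 (mod 8)` (Case 1; Bott 1959, Hatcher Example 4.55: `πᵢ O = 0` for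
  `i ≡ 2, 4, 5, 6 (mod 8)`, in the stable range `i < (n + 1) - 1`), and (ii) the statement itself
  in the dimensions `n = 4` and `n ≡ 0, 1, 2, 4 (mod 8)`, `n ≥ 8` (Cases 2 and 3 of the printed
  proof: Pontryagin classes and the Hirzebruch signature theorem; Rohlin's theorem and Adams'
  injectivity of `J`). This records exactly what of Thm. 3.1 remains unmechanised.

## References

* M. Kervaire, J. Milnor, *Groups of homotopy spheres I*, Ann. of Math. (2) 77 (1963),
  504–537: §3, Thm. 3.1 and its proof, pp. 508–509 (table of `πₙ₋₁(SO)`; Cases 1–3); §2,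
  p. 507 (`Θ₁ = Θ₂ = 0`, `Θ₃` and the Poincaré hypothesis). doi:10.2307/1970128
  [KervaireMilnorAnnals1963]
* A. Hatcher, *Algebraic Topology*, Cambridge University Press (2002): §3.D (`SO(3) ≈ ℝP³`, the
  universal cover `S³ → SO(3)`; held copy pp. 378–379), Prop. 4.1 (coverings induce
  isomorphisms on `πₙ`, `n ≥ 2`; held copy p. 447), Cor. 4.9 (`πᵢ(Sⁿ) = 0`, `i < n`; held copy
  p. 455), §4.1 p. 346 (criteria for `πₙ = 0`), §4.2 Example 4.55 (stability of `πᵢ O(n)` and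
  Bott's table; held copy pp. 498–499). [HatcherAT2002]
* R. Bott, *The stable homotopy of the classical groups*, Ann. of Math. (2) 70 (1959), 313–337,
  §1, Corollary to Thm. II, (1.5), p. 315. doi:10.2307/1970106 [Bott1959]
-/

noncomputable section

open Literature.AlgebraicTopology.Homotopy Literature.AlgebraicTopology.FundamentalGroup
open scoped Manifold Topology Topology.Homotopy Quaternion Matrix
open Set Metric

namespace Literature.Topology.FourManifolds

/-! ### 1. `π₂(SO(3), 1) = 0` -/

section PiTwo

/-- Membership in Mathlib's `SO(3) = Matrix.specialOrthogonalGroup (Fin 3) ℝ` is `Mᵀ M = 1 ∧ det M = 1`,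
the defining condition of the tree's `SO3` (`RotationGroupSO3.lean`). [folklore] -/
theorem mem_specialOrthogonalGroup_fin_three_iff (M : Matrix (Fin 3) (Fin 3) ℝ) :
    M ∈ Matrix.specialOrthogonalGroup (Fin 3) ℝ ↔ Mᵀ * M = 1 ∧ M.det = 1 := by
  rw [Matrix.mem_specialOrthogonalGroup_iff, Matrix.mem_orthogonalGroup_iff']

/-- **Every continuous map `𝕊² → S³` is null-homotopic** (`S³` the unit quaternions): `π₂(S³) = 0`
(the tree's `subsingleton_homotopyGroup_sphere`, Hatcher Cor. 4.9) at every base point of the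
path-connected `S³`, and Hatcher's criterion §4.1 (3) ⇒ (1)
(`homotopic_const_of_sphere_of_subsingleton_homotopyGroup`). [cite: HatcherAT2002, Cor. 4.9 and §4.1 (p. 346)] -/
theorem nullhomotopic_of_sphere_two_quaternionSphere
    (k : C(sphere (0 : EuclideanSpace ℝ (Fin 3)) 1, sphere (0 : ℍ) 1)) : k.Nullhomotopic := by
  have h4 : Module.finrank ℝ ℍ = 4 := Quaternion.finrank_eq_four
  have hrk : 1 < Module.rank ℝ ℍ := by
    rw [← Module.finrank_eq_rank, h4]
    norm_num
  haveI : PathConnectedSpace (sphere (0 : ℍ) 1) :=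
    isPathConnected_iff_pathConnectedSpace.mp (isPathConnected_sphere hrk 0 zero_le_one)
  have h3 : 2 + 1 < Module.finrank ℝ ℍ := by
    rw [h4]
    norm_num
  have hπ : 1 ≤ 2 → ∀ y : sphere (0 : ℍ) 1, Subsingleton (π_ 2 (sphere (0 : ℍ) 1) y) :=
    fun _ y => subsingleton_homotopyGroup_sphere (E := ℍ) (k := 2) h3 y
  have hE : Module.finrank ℝ (EuclideanSpace ℝ (Fin 3)) = 2 + 1 := finrank_euclideanSpace_fin
  have hk : k.Homotopic (ContinuousMap.const _ (1 : sphere (0 : ℍ) 1)) :=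
    homotopic_const_of_sphere_of_subsingleton_homotopyGroup (m := 2) hE hπ k 1
  exact ⟨1, hk⟩

/-- **Every continuous map `𝕊² → SO(3)` is null-homotopic** (for the tree's `SO3`): lift it
through the covering `rotHom : S³ → SO(3)` (`isCoveringMap_rotHom`; the sphere `𝕊²` is simply
connected, `simplyConnectedSpace_euclideanSphere`, and locally path connected as a manifold, so
Mathlib's lifting criterion `IsCoveringMap.existsUnique_continuousMap_lifts` applies), contract
the lift in `S³` (`nullhomotopic_of_sphere_two_quaternionSphere`) and project the null-homotopy
back down. This is `π₂(SO(3)) = π₂(S³) = 0` (Hatcher §3.D: `S³ → SO(3)` is the universal cover;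
Prop. 4.1: coverings induce isomorphisms on `πₙ`, `n ≥ 2`). [cite: HatcherAT2002, §3.D and Prop. 4.1] -/
theorem nullhomotopic_of_sphere_two_SO3 (k : C(sphere (0 : EuclideanSpace ℝ (Fin 3)) 1, SO3)) :
    k.Nullhomotopic := by
  haveI : SimplyConnectedSpace (sphere (0 : EuclideanSpace ℝ (Fin 3)) 1) :=
    simplyConnectedSpace_euclideanSphere (n := 2) le_rfl
  haveI : LocallyPathConnectedSpace (sphere (0 : EuclideanSpace ℝ (Fin 3)) 1) :=
    ChartedSpace.locallyPathConnectedSpace (EuclideanSpace ℝ (Fin 2)) _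
  let u₀ : sphere (0 : EuclideanSpace ℝ (Fin 3)) 1 := ⟨EuclideanSpace.single 0 1, by simp⟩
  obtain ⟨q₀, hq₀⟩ := surjective_rotHom (k u₀)
  obtain ⟨K, -, hK⟩ :=
    (isCoveringMap_rotHom.existsUnique_continuousMap_lifts k u₀ q₀ hq₀).exists
  obtain ⟨q₁, hq₁⟩ := nullhomotopic_of_sphere_two_quaternionSphere K
  let R : C(sphere (0 : ℍ) 1, SO3) := ⟨rotHom, continuous_rotHom⟩
  have hk : R.comp K = k := ContinuousMap.ext fun u => congr_fun hK u
  have h1 : (R.comp K).Homotopic (R.comp (ContinuousMap.const _ q₁)) :=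
    (ContinuousMap.Homotopic.refl R).comp hq₁
  rw [hk] at h1
  exact ⟨rotHom q₁, h1⟩

/-- **Every continuous map `𝕊² → SO(3)` is null-homotopic**, for Mathlib's
`Matrix.specialOrthogonalGroup (Fin 3) ℝ`: transport of `nullhomotopic_of_sphere_two_SO3` along
the identification with the tree's `SO3` (the same subspace `{M | Mᵀ M = 1, det M = 1}` of
`M₃(ℝ)`, `mem_specialOrthogonalGroup_fin_three_iff`; the identity of matrices is a homeomorphism).
[cite: HatcherAT2002, §3.D (universal cover S³ → SO(3)) and Prop. 4.1] -/
theorem nullhomotopic_of_sphere_two_specialOrthogonalGroup_three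
    (k : C(sphere (0 : EuclideanSpace ℝ (Fin 3)) 1, Matrix.specialOrthogonalGroup (Fin 3) ℝ)) :
    k.Nullhomotopic := by
  -- Mathlib's `SO(3)` and the tree's `SO3` are the same subspace of `M₃(ℝ)`
  let e : Matrix.specialOrthogonalGroup (Fin 3) ℝ ≃ₜ SO3 :=
    { toFun := fun A => ⟨A.1, (mem_specialOrthogonalGroup_fin_three_iff A.1).1 A.2⟩
      invFun := fun B => ⟨B.1, (mem_specialOrthogonalGroup_fin_three_iff B.1).2 B.2⟩
      left_inv := fun _ => Subtype.ext rfl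
      right_inv := fun _ => Subtype.ext rfl
      continuous_toFun := continuous_subtype_val.subtype_mk _
      continuous_invFun := continuous_subtype_val.subtype_mk _ }
  let ec : C(Matrix.specialOrthogonalGroup (Fin 3) ℝ, SO3) := ⟨e, e.continuous⟩
  let esc : C(SO3, Matrix.specialOrthogonalGroup (Fin 3) ℝ) := ⟨e.symm, e.symm.continuous⟩
  obtain ⟨B, hB⟩ := nullhomotopic_of_sphere_two_SO3 (ec.comp k)
  have hk : esc.comp (ec.comp k) = k := by
    ext u : 1
    exact e.symm_apply_apply (k u)
  have h1 : (esc.comp (ec.comp k)).Homotopic (esc.comp (ContinuousMap.const _ B)) :=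
    (ContinuousMap.Homotopic.refl esc).comp hB
  rw [hk] at h1
  exact ⟨e.symm B, h1⟩

/-- **`π₂(SO(3), 1) = 0`** for Mathlib's `HomotopyGroup (Fin 2)` of
`Matrix.specialOrthogonalGroup (Fin 3) ℝ` at `1`: all maps `𝕊² → SO(3)` are null-homotopic
(`nullhomotopic_of_sphere_two_specialOrthogonalGroup_three`), which is Hatcher's criterion
§4.1 (1) ⇒ (3) (`subsingleton_homotopyGroup_specialOrthogonalGroup_of_nullhomotopic`). The value
`π₂(SO(3)) = 0` is the entry `n = 3` (`π₂(SO) = 0`, `n ≡ 3 (mod 8)`) of the table in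
Kervaire–Milnor's proof of Thm. 3.1, p. 508, here obtained from the universal cover
`S³ → SO(3)` rather than from Bott periodicity. [cite: HatcherAT2002, §3.D, Prop. 4.1, §4.1 (p. 346)]
[cite: KervaireMilnorAnnals1963, §3, proof of Thm. 3.1, p. 508 (table: π₂(SO) = 0)] -/
theorem subsingleton_homotopyGroup_two_specialOrthogonalGroup_three :
    Subsingleton (π_ 2 (Matrix.specialOrthogonalGroup (Fin 3) ℝ) 1) :=
  subsingleton_homotopyGroup_specialOrthogonalGroup_of_nullhomotopic
    nullhomotopic_of_sphere_two_specialOrthogonalGroup_three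

/-- **`π₂(SO(D), 1) = 0` for every `D ≥ 3`** (É. Cartan; Hatcher §4.2, Example 4.55 and the
stability paragraph after it): from `π₂(SO(3)) = 0` by the surjectivity half of stability,
`π₂(SO(D)) → π₂(SO(D + 1))` onto for `2 < D` (the tree's
`subsingleton_homotopyGroup_specialOrthogonalGroup_succ_of`). [cite: HatcherAT2002, §4.2, Example 4.55] -/
theorem subsingleton_homotopyGroup_two_specialOrthogonalGroup {D : ℕ} (hD : 3 ≤ D) :
    Subsingleton (π_ 2 (Matrix.specialOrthogonalGroup (Fin D) ℝ) 1) := by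
  induction D, hD using Nat.le_induction with
  | base => exact subsingleton_homotopyGroup_two_specialOrthogonalGroup_three
  | succ D hD ih => exact subsingleton_homotopyGroup_specialOrthogonalGroup_succ_of (by omega) ih

end PiTwo

/-! ### 2. Case 1 of Kervaire–Milnor's proof, parametrised by the value `πₙ(SO(n + 2)) = 0` -/

namespace HomotopySphere

variable {n : ℕ}

/-- **Case 1 of the proof of Thm. 3.1 in dimension `n + 1`, from the single input
`π_ n (SO(n + 2), 1) = 0`** (`n ≥ 1`; Mathlib's `HomotopyGroup (Fin n)` of
`Matrix.specialOrthogonalGroup (Fin (n + 2)) ℝ` at `1`): every homotopy `(n + 1)`-sphere is then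
s-parallelizable. Kervaire–Milnor, p. 508: the obstruction `o_{n+1}(Σ)` lives in
`πₙ(SO_{n+2}) = πₙ(SO)` and "is trivially zero" when that group vanishes. Formally: the value
feeds `sphereMapsToStableFramesExtend_iff_subsingleton_homotopyGroup_specialOrthogonalGroup`
(extension of sphere maps into the stable frames), then the clutching theorem
`isStablyParallelizable_succ_of` together with the PROVED framing of `τ ⊕ ε¹` off a point
(`hasStableTangentFramingAlong_compl_singleton_holds`).
[cite: KervaireMilnorAnnals1963, §3, proof of Thm. 3.1, p. 508 (Case 1: πₙ₋₁(SO) = 0 ⇒ oₙ(Σ) = 0)] -/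
theorem isStablyParallelizable_of_subsingleton_homotopyGroup_specialOrthogonalGroup (hn : 1 ≤ n)
    (h : Subsingleton (π_ n (Matrix.specialOrthogonalGroup (Fin (n + 2)) ℝ) 1))
    (S : HomotopySphere (n + 1)) : IsStablyParallelizable (𝓡 (n + 1)) S.carrier :=
  isStablyParallelizable_succ_of
    ((sphereMapsToStableFramesExtend_iff_subsingleton_homotopyGroup_specialOrthogonalGroup hn).2 h)
    hasStableTangentFramingAlong_compl_singleton_holds S

/-- **Case 1 one rung below the stable range**: for `n ≥ 1`, `π_ n (SO(n + 1), 1) = 0` already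
implies that every homotopy `(n + 1)`-sphere is s-parallelizable
(`sphereMapsToStableFramesExtend_of_specialOrthogonalGroup_succ`: `πₙ(SO(n + 1)) → πₙ(SO(n + 2))`
is onto since `πₙ(𝕊ⁿ⁺¹) = 0`, Hatcher Example 4.55).
[cite: KervaireMilnorAnnals1963, §3, proof of Thm. 3.1, p. 508 (Case 1)] [cite: HatcherAT2002, §4.2, Example 4.55] -/
theorem isStablyParallelizable_of_subsingleton_homotopyGroup_specialOrthogonalGroup_succ
    (hn : 1 ≤ n) (h : Subsingleton (π_ n (Matrix.specialOrthogonalGroup (Fin (n + 1)) ℝ) 1))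
    (S : HomotopySphere (n + 1)) : IsStablyParallelizable (𝓡 (n + 1)) S.carrier :=
  isStablyParallelizable_succ_of (sphereMapsToStableFramesExtend_of_specialOrthogonalGroup_succ hn h)
    hasStableTangentFramingAlong_compl_singleton_holds S

/-! ### 3. Dimensions `2` and `3` unconditionally; the fact reduces to `n ≥ 4` -/

/-- **Thm. 3.1 in dimension `3`, unconditionally: every homotopy `3`-sphere is
s-parallelizable.** Case 1 of the printed proof at `n = 3` (`3 ≡ 3 (mod 8)`, `π₂(SO) = 0`), with
the value `π₂(SO(3), 1) = 0` PROVED in §1 from the universal cover `S³ → SO(3)`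
(`subsingleton_homotopyGroup_two_specialOrthogonalGroup_three`) in place of Bott's table, fed to
`isStablyParallelizable_of_subsingleton_homotopyGroup_specialOrthogonalGroup_succ`. No appeal to
the Poincaré conjecture (contrast `isStablyParallelizable_three_of`).
[cite: KervaireMilnorAnnals1963, §3, Thm. 3.1 and its proof, p. 508 (Case 1 at n = 3: π₂(SO) = 0)]
[cite: HatcherAT2002, §3.D and Prop. 4.1 (π₂(SO(3)) = π₂(S³) = 0)] -/
theorem isStablyParallelizable_three (S : HomotopySphere 3) :
    IsStablyParallelizable (𝓡 3) S.carrier :=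
  isStablyParallelizable_of_subsingleton_homotopyGroup_specialOrthogonalGroup_succ (n := 2)
    (by norm_num) subsingleton_homotopyGroup_two_specialOrthogonalGroup_three S

/-- **Thm. 3.1 in dimension `2`, unconditionally**: `Θ₂ = 0` is a theorem of the tree
(`nonemptyDiffeomorphSphere_two_holds`, `SmoothPoincareTwoHolds.lean`), so every homotopy
`2`-sphere is diffeomorphic to `𝕊²` and hence s-parallelizable (`isStablyParallelizable_two_of`).
Kervaire–Milnor, p. 507: "It follows that `Θ₂ = 0`"; their proof of Thm. 3.1 at `n = 2` is
Case 3 (p. 509). [cite: KervaireMilnorAnnals1963, §3, Thm. 3.1 (p. 508), n = 2 via §2 p. 507 (Θ₂ = 0)] -/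
theorem isStablyParallelizable_two (S : HomotopySphere 2) :
    IsStablyParallelizable (𝓡 2) S.carrier :=
  isStablyParallelizable_two_of nonemptyDiffeomorphSphere_two_holds S

/-- **Thm. 3.1 in dimensions `n ≤ 3`, unconditionally** (`isStablyParallelizable_zero`, `_one`,
`_two`, `_three`). [cite: KervaireMilnorAnnals1963, §3, Thm. 3.1 (p. 508), n ≤ 3] -/
theorem isStablyParallelizable_of_le_three (hn : n ≤ 3) (S : HomotopySphere n) :
    IsStablyParallelizable (𝓡 n) S.carrier := by
  interval_cases n
  · exact S.isStablyParallelizable_zero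
  · exact S.isStablyParallelizable_one
  · exact S.isStablyParallelizable_two
  · exact S.isStablyParallelizable_three

/-- **The named fact `HomotopySphere.isStablyParallelizable` reduces to dimensions `n ≥ 4`**:
dimensions `n ≤ 3` are the unconditional `isStablyParallelizable_of_le_three`.
[cite: KervaireMilnorAnnals1963, §3, Thm. 3.1 and its proof, pp. 508–509] -/
theorem isStablyParallelizable_of_four_le
    (h : ∀ n : ℕ, 4 ≤ n → ∀ S : HomotopySphere n, IsStablyParallelizable (𝓡 n) S.carrier) :
    isStablyParallelizable := by
  intro n S
  rcases Nat.lt_or_ge n 4 with hn | hn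
  · exact isStablyParallelizable_of_le_three (by omega) S
  · exact h n hn S

/-! ### 4. Dimensions `5`, `6`, `7` from Bott's values, and the assembly -/

/-- **Thm. 3.1 in dimension `5` from Bott's value `π₄(SO(6), 1) = 0`** (Case 1, `5 ≡ 5 (mod 8)`:
`π₄(SO) = 0`; `π₄(SO(6)) ≅ π₄(SO)` is in the stable range, Hatcher Example 4.55).
[cite: KervaireMilnorAnnals1963, §3, proof of Thm. 3.1, p. 508 (Case 1 at n = 5: π₄(SO) = 0)]
[cite: Bott1959, §1, Corollary to Thm. II, (1.5), p. 315] -/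
theorem isStablyParallelizable_five_of
    (h : Subsingleton (π_ 4 (Matrix.specialOrthogonalGroup (Fin 6) ℝ) 1)) (S : HomotopySphere 5) :
    IsStablyParallelizable (𝓡 5) S.carrier :=
  isStablyParallelizable_of_subsingleton_homotopyGroup_specialOrthogonalGroup (n := 4)
    (by norm_num) h S

/-- **Thm. 3.1 in dimension `6` from Bott's value `π₅(SO(7), 1) = 0`** (Case 1, `6 ≡ 6 (mod 8)`:
`π₅(SO) = 0`; stable range). [cite: KervaireMilnorAnnals1963, §3, proof of Thm. 3.1, p. 508 (Case 1 at n = 6: π₅(SO) = 0)]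
[cite: Bott1959, §1, Corollary to Thm. II, (1.5), p. 315] -/
theorem isStablyParallelizable_six_of
    (h : Subsingleton (π_ 5 (Matrix.specialOrthogonalGroup (Fin 7) ℝ) 1)) (S : HomotopySphere 6) :
    IsStablyParallelizable (𝓡 6) S.carrier :=
  isStablyParallelizable_of_subsingleton_homotopyGroup_specialOrthogonalGroup (n := 5)
    (by norm_num) h S

/-- **Thm. 3.1 in dimension `7` from Bott's value `π₆(SO(8), 1) = 0`** (Case 1, `7 ≡ 7 (mod 8)`:
`π₆(SO) = 0`; stable range) — the tree's `isStablyParallelizable_seven_of` with both its leaves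
resolved: `hasStableTangentFramingAlong_compl_singleton` is proved and
`Bott1959_sphereMapsToStableFramesExtend_six` is replaced by its proved equivalent
`π₆(SO(8), 1) = 0` (`Bott1959_sphereMapsToStableFramesExtend_six_iff_specialOrthogonalGroup`).
[cite: KervaireMilnorAnnals1963, §3, proof of Thm. 3.1, p. 508 (Case 1 at n = 7: π₆(SO) = 0)]
[cite: Bott1959, §1, Corollary to Thm. II, (1.5), p. 315] -/
theorem isStablyParallelizable_seven_of_specialOrthogonalGroup
    (h : Subsingleton (π_ 6 (Matrix.specialOrthogonalGroup (Fin 8) ℝ) 1)) (S : HomotopySphere 7) :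
    IsStablyParallelizable (𝓡 7) S.carrier :=
  isStablyParallelizable_of_subsingleton_homotopyGroup_specialOrthogonalGroup (n := 6)
    (by norm_num) h S

/-- **What remains of Thm. 3.1**: the named fact `HomotopySphere.isStablyParallelizable` follows
from (i) Bott's values `π_ (n - 1) (SO(n + 1), 1) = 0` for `n ≥ 5` with `n ≡ 3, 5, 6, 7 (mod 8)`
— the input of Case 1 (Kervaire–Milnor p. 508: `πₙ₋₁(SO_{n+1}) = πₙ₋₁(SO) = 0` by Bott's table;
Hatcher Example 4.55: `πᵢ O = 0` for `i ≡ 2, 4, 5, 6 (mod 8)`, `i = n - 1` in the stable range of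
`O(n + 1)`) — and (ii) the statement itself in dimension `4` and in dimensions `n ≥ 8` with
`n ≡ 0, 1, 2, 4 (mod 8)` — Cases 2 and 3 of the printed proof (Pontryagin classes and the
Hirzebruch signature theorem; Rohlin's `J ∘ oₙ = 0` and Adams' injectivity of `Jₙ₋₁`), whose
inputs are absent from the tree. Dimensions `≤ 3` are unconditional (Case 1 at `n = 3` by §1).
[cite: KervaireMilnorAnnals1963, §3, proof of Thm. 3.1, pp. 508–509 (Cases 1, 2, 3)]
[cite: HatcherAT2002, §4.2, Example 4.55 (Bott's table, stability)] -/
theorem isStablyParallelizable_of_bott_of_cases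
    (hBott : ∀ n : ℕ, 5 ≤ n → (n % 8 = 3 ∨ n % 8 = 5 ∨ n % 8 = 6 ∨ n % 8 = 7) →
      Subsingleton (π_ (n - 1) (Matrix.specialOrthogonalGroup (Fin (n + 1)) ℝ) 1))
    (hRest : ∀ n : ℕ, 4 ≤ n → (n % 8 = 0 ∨ n % 8 = 1 ∨ n % 8 = 2 ∨ n % 8 = 4) →
      ∀ S : HomotopySphere n, IsStablyParallelizable (𝓡 n) S.carrier) :
    isStablyParallelizable := by
  refine isStablyParallelizable_of_four_le fun n hn S => ?_
  by_cases hres : n % 8 = 3 ∨ n % 8 = 5 ∨ n % 8 = 6 ∨ n % 8 = 7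
  · have h5 : 5 ≤ n := by omega
    obtain ⟨m, rfl⟩ : ∃ m, n = m + 1 := ⟨n - 1, by omega⟩
    have hπ := hBott (m + 1) h5 hres
    simp only [Nat.add_sub_cancel] at hπ
    exact isStablyParallelizable_of_subsingleton_homotopyGroup_specialOrthogonalGroup (n := m)
      (by omega) hπ S
  · exact hRest n hn (by omega) S

end HomotopySphere

end Literature.Topology.FourManifolds
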